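import Summits.NavierStokesRegularity.NavierStokesRegularity.Theses.FlatSwirlGauge
import Summits.NavierStokesRegularity.NavierStokesRegularity.Theorems.AxisymmetricExtremalityAxisymmetricKatoGlobalStubAxisBoundedOfLocalEnergyOrigin
import Summits.NavierStokesRegularity.NavierStokesRegularity.Theorems.AxisymmetricExtremalityAxisymmetricKatoGlobalStubOffAxisBoundedOfLocalEnergy
import Summits.NavierStokesRegularity.NavierStokesRegularity.Theorems.AxisymmetricExtremalityAxisymmetricKatoGlobalStubKatoLocalEnergyNearTop
import Literature.Analysis.FluidPDE.Seregin2022LogSwirlCriterion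
import Literature.Analysis.FluidPDE.NSCriticalClosureBesovKatoClass

/-!
# Route FlatSwirlGauge — the exactly-flat shadow of the crux `CriticalSwirlRegularity`:
# settled OFF the axis, and reduced to Seregin 2022 ON the axis under a local log³ swirl modulus

Negative-side (dossier) support file for the crux `CriticalSwirlRegularity` (CSR, item
`stmt-NavierStokesRegularity-1253`, route `FlatSwirlGauge` of NavierStokesRegularity), written by the line lead
(continuation c9) of the dead line `registered`, next to `HardnessSandwich.lean` (c4), `StubStatus.lean` (c5),
`IrrotationalCase.lean` (c7) and `GaugeElimination.lean` (c8).

`HardnessSandwich.lean` records `NoBlowup ⟹ CSR ⟹ (exactly-flat shadow)`, the shadow being: a classical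
Leray–Hopf solution on `[0, T)` from a rapidly decaying datum with axisymmetric slices, carrying the KNSS gauge
`α = Γ = r u_θ` on a backward cylinder at `(T, x₀)`, is bounded near `(T, x₀)`. This file sharpens WHERE that
shadow is open, with three machine-checked statements about the route's exact class of solutions
(`IsClassicalNSSolutionOn (Ico 0 T) ν 0 u p`, `IsLerayHopfOn T ν 0 (u 0) u`, `HasRapidSpatialDecay (u 0)`),
assuming axisymmetry of the VELOCITY slices only (the pressure is free: an axisymmetric pressure making the
solution suitable on the open strip, with local energy classes reaching `T`, is supplied by the tree —
`stub_katoLocalEnergyNearTop` of the crux `AxisymmetricKatoGlobal` of route AxisymmetricExtremality applied to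
the Kato solution `isKatoSolutionOn_of_classical`):

* `csrShadow_offAxis` (UNCONDITIONAL): at every point `x₀` OFF the axis the conclusion of CSR holds, with no
  gauge hypothesis at all — singular points of axisymmetric suitable weak solutions lie on the axis (CKN 1982 /
  Seregin 2014 Ch. 6 Thm. 1.4, proved in tree; here through the landed `stub_offAxisBounded_of_localEnergy`).
  So the exactly-flat shadow of CSR — and of every restatement of CSR over the same class — is open ONLY at
  axis points. (Second settled sub-case of the crux after the irrotational one of c7.)
* `boundedNearTop_axis_of_localLogModulus` (transfer, no Navier–Stokes content): the LOCAL-hypothesis variant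
  of the landed transfer stub `stub_axisBounded_of_localEnergy_origin` of the crux `AxisymmetricKatoGlobal`
  (there the log modulus of the swirl is imposed along the whole axis, `cylRadius x ≤ δ₀`; here only on a ball
  `B_{ρ₀}(x₀)` — the zoom scale is shrunk below `ρ₀ / 2`, everything else is that proof verbatim).
* `csrShadow_axis_of_seregin2022` / `csrShadow_of_seregin2022` (CONDITIONAL on the named fact
  `Literature.Analysis.FluidPDE.seregin2022_logSwirl_regularAtOrigin` = G. Seregin, J. Math. Fluid Mech. 24
  (2022) §2, a published theorem, undischarged in the tree): at an axis point `x₀`, a LOCAL logarithmic modulus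
  `|Γ(t, x)| ≤ C / |log r|³` (`x ∈ B_{ρ₀}(x₀)`, `r = cylRadius x ≤ δ₀ < 1`, `t₀ ≤ t < T`) forces boundedness of
  `u` near `(T, x₀)`.

READING FOR THE RESTATEMENT MENU of the dead-line dossiers (D2/D3/D4, `Cruxes/CriticalSwirlRegularity/Lines/`):
the D4 restatement of CSR — the v0 gauge block plus a scale-invariant log-Dirichlet clause on the momentum at
the degeneracy set, `|α(t,x)| ≤ C₁ ν / log³(e ρ / d(t,x))` where `0 < d < ρ` — has, in its exactly-flat
instance `α = Γ`, `d = r`, a shadow that is NOT an open problem: it is Seregin's 2022 local criterion, in print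
and in tree, and `csrShadow_of_seregin2022` is the checked derivation for the route's class at every point
(any viscosity, any axis point, local hypothesis). This puts a D4-restated 1253 in the same epistemic position
as crux 1254 (`FlatGaugeExcludesTypeI`, whose exactly-flat case is the printed Seregin–Šverák 2009 theorem):
"de-symmetrise a printed axisymmetric theorem", instead of "at least as hard as an open problem"
(`bounded_of_criticalSwirlRegularity_of_axisymmetric`, c4). Nothing here is new mathematics.

## References

* G. Seregin, *A note on local regularity of axisymmetric solutions to the Navier–Stokes equations*, J. Math.
  Fluid Mech. 24 (2022), Paper No. 27 = arXiv:2201.00153, §2, Thm. 1.2. [Seregin2022LocalAxisym]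
* L. Caffarelli, R. Kohn, L. Nirenberg, Comm. Pure Appl. Math. 35 (1982), Prop. 2 / Thm. B. [CKN1982]
* G. Seregin, V. Šverák, Comm. PDE 34 (2009) = arXiv:0804.1803, §4 (axis-centred rescaling). [SereginSverak2009]
* P. G. Lemarié-Rieusset, *The Navier–Stokes Problem in the 21st Century*, CRC 2016, Thm. 15.1 (A)–(B)
  (classical Leray–Hopf solutions are Kato solutions). [LemarieRieusset2016]
-/

noncomputable section

-- the summit and its single sub-problem share the name (CONVENTIONS §1), as in every Theorems file
set_option linter.dupNamespace false

open Set MeasureTheory Filter Topology Function Metric Module Literature.Analysis.FluidPDE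
open scoped ENNReal NNReal
open Summit.NavierStokesRegularity.NavierStokesRegularity.Theorems.AxisymmetricKatoGlobal.Registered

namespace Summit.NavierStokesRegularity.NavierStokesRegularity.Theorems.CriticalSwirlRegularity.Negative

/-! ### The route's class: smoothness on the open strip, and the axisymmetric suitable pressure -/

/-- A classical solution on `[0, T)` is smooth on the open strip `(0, T) × ℝ³` (restriction of
`IsClassicalNSSolutionOn.smooth_velocity`). [folklore] -/
theorem contDiffOn_Ioo_of_classical {ν T : ℝ} {u : ℝ → (EuclideanSpace ℝ (Fin 3)) → (EuclideanSpace ℝ (Fin 3))} {p : ℝ → (EuclideanSpace ℝ (Fin 3)) → ℝ}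
    (hcl : IsClassicalNSSolutionOn (Ico 0 T) ν 0 u p) :
    ContDiffOn ℝ (⊤ : ℕ∞) (uncurry u) (Ioo 0 T ×ˢ univ) :=
  hcl.smooth_velocity.mono Ioo_subset_Ico_self

/-- **The axisymmetric suitable pressure of the route's class.** For `ν > 0`, `T > 0` and a classical
solution `(u, p)` on `ℝ³ × [0, T)`, Leray–Hopf from its rapidly decaying datum, with axisymmetric velocity
slices on `(0, T)`, there is a pressure `q` with axisymmetric slices such that `(u, q)` is a suitable weak
solution on the open strip `(0, T) × ℝ³` whose local energy classes (`L^∞_t L²_x`, `∇u ∈ L²`, `q ∈ L^{3/2}`)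
reach the final time on every `(t₁, T) × B_ρ(0)`. The given pressure `p` plays no role. Proof: `u` is the
Kato solution from `u 0` (`isKatoSolutionOn_of_classical`, Lemarié-Rieusset 2016 Thm. 15.1), and the landed
`stub_katoLocalEnergyNearTop` (crux `AxisymmetricKatoGlobal`, normalised pressure) applies.
[cite: LemarieRieusset2016, Thm. 15.1 (A)-(B)] -/
theorem exists_axisymmetric_suitable_pressure {ν T : ℝ} (hν : 0 < ν) (hT : 0 < T)
    {u : ℝ → (EuclideanSpace ℝ (Fin 3)) → (EuclideanSpace ℝ (Fin 3))} {p : ℝ → (EuclideanSpace ℝ (Fin 3)) → ℝ}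
    (hcl : IsClassicalNSSolutionOn (Ico 0 T) ν 0 u p) (hLH : IsLerayHopfOn T ν 0 (u 0) u)
    (hdec : HasRapidSpatialDecay (u 0)) (hax : ∀ t ∈ Ioo 0 T, IsAxisymmetric (u t)) :
    ∃ q : ℝ → (EuclideanSpace ℝ (Fin 3)) → ℝ,
      (∀ t ∈ Ioo 0 T, IsAxisymmetricScalar (q t)) ∧
      IsSuitableWeakSolutionOn (slab (EuclideanSpace ℝ (Fin 3)) (Ioo 0 T) isOpen_Ioo) ν 0 u q ∧
      ∀ t₁ ∈ Ioo 0 T, ∀ ρ : ℝ, 0 < ρ →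
        (∃ C : ℝ≥0, ∀ t ∈ Ioo t₁ T, ∫⁻ x in ball (0 : (EuclideanSpace ℝ (Fin 3))) ρ, ‖u t x‖ₑ ^ 2 ≤ C) ∧
        (∫⁻ z in Ioo t₁ T ×ˢ ball (0 : (EuclideanSpace ℝ (Fin 3))) ρ,
            ENNReal.ofReal (frobeniusNormSq (fderiv ℝ (u z.1) z.2)) < ∞) ∧
        (∫⁻ z in Ioo t₁ T ×ˢ ball (0 : (EuclideanSpace ℝ (Fin 3))) ρ, ‖q z.1 z.2‖ₑ ^ (3 / 2 : ℝ) < ∞) :=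
  stub_katoLocalEnergyNearTop ν hν T hT (u 0) u (isKatoSolutionOn_of_classical hν hT hcl hLH hdec)
    (contDiffOn_Ioo_of_classical hcl) hax

/-! ### Off the axis: the shadow of the crux holds unconditionally -/

/-- **The exactly-flat shadow of `CriticalSwirlRegularity` HOLDS at every off-axis point, with no gauge
hypothesis.** For `ν > 0`, `T > 0`, a classical solution `(u, p)` on `ℝ³ × [0, T)`, Leray–Hopf from its rapidly
decaying datum, with axisymmetric velocity slices on `(0, T)`, and any `x₀` with `cylRadius x₀ ≠ 0`, `u` is
bounded on some `(T − r², T) × B_r(x₀)` — the conclusion of the crux verbatim. Singular points of axisymmetric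
suitable weak solutions with finite local dissipation lie on the axis (Caffarelli–Kohn–Nirenberg 1982 Thm. B
by the rotation count; backward one-scale form Seregin 2014, Ch. 6, Thm. 1.4, proved in tree), here through
the landed `stub_offAxisBounded_of_localEnergy` (crux `AxisymmetricKatoGlobal`) and
`exists_axisymmetric_suitable_pressure`. Consequently the crux restricted to axisymmetric solutions — in
particular the lower bound `bounded_of_criticalSwirlRegularity_of_axisymmetric` of `HardnessSandwich.lean` —
is open ONLY at axis points. [cite: CKN1982, Thm. B] -/
theorem csrShadow_offAxis {ν T : ℝ} (hν : 0 < ν) (hT : 0 < T)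
    {u : ℝ → (EuclideanSpace ℝ (Fin 3)) → (EuclideanSpace ℝ (Fin 3))} {p : ℝ → (EuclideanSpace ℝ (Fin 3)) → ℝ}
    (hcl : IsClassicalNSSolutionOn (Ico 0 T) ν 0 u p) (hLH : IsLerayHopfOn T ν 0 (u 0) u)
    (hdec : HasRapidSpatialDecay (u 0)) (hax : ∀ t ∈ Ioo 0 T, IsAxisymmetric (u t))
    {x₀ : (EuclideanSpace ℝ (Fin 3))} (hx₀ : cylRadius x₀ ≠ 0) :
    ∃ r : ℝ, 0 < r ∧ ∃ K : ℝ, ∀ t ∈ Ioo (T - r ^ 2) T, 0 ≤ t → ∀ x ∈ ball x₀ r, ‖u t x‖ ≤ K := by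
  obtain ⟨q, -, hsw, hcls⟩ := exists_axisymmetric_suitable_pressure hν hT hcl hLH hdec hax
  obtain ⟨r, hr, K, hK⟩ := stub_offAxisBounded_of_localEnergy ν hν T hT u q
    (contDiffOn_Ioo_of_classical hcl) hax hsw hcls x₀ hx₀
  exact ⟨r, hr, K, fun t ht _ x hx => hK t ht x hx⟩

/-! ### On the axis: transfer of Seregin's local log³-swirl criterion under a LOCAL modulus -/

/-- **Transfer of the local log³-swirl criterion to an axis point, LOCAL hypothesis.** The landed transfer
stub `stub_axisBounded_of_localEnergy_origin` of the crux `AxisymmetricKatoGlobal` with its swirl-modulus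
hypothesis localised to a ball `B_{ρ₀}(x₀)` around the axis point `x₀` (there: all `x` with
`cylRadius x ≤ δ₀`). GIVEN the local criterion (first hypothesis; it is
`Literature.Analysis.FluidPDE.seregin2022_logSwirl_regularAtOrigin` unfolded), a suitable weak solution
`(u, p)` (viscosity `ν > 0`) on the open strip `(0, T) × ℝ³`, `u` smooth with axisymmetric slices, `p` with
axisymmetric slices, local energy classes reaching `T` on every `(t₁, T) × B_ρ(0)`, and the swirl modulus
`|Γ(t, x)| ≤ C / |log (cylRadius x)|³` for `t₀ ≤ t < T`, `x ∈ B_{ρ₀}(x₀)`, `cylRadius x ≤ δ₀ < 1`, is bounded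
near `(T, x₀)`. Proof: verbatim the landed one (zoom `Φ(s, y) = (T + (λ²/ν) s, x₀ + λ y)`, viscosity
normalisation, change of variables for the three classes, axisymmetry and scale invariance of the swirl,
`|log (λ r)| ≥ log (e/r)`, transport of the essential bound back), with the scale `λ ≤ min (δ₀, ρ₀/2)` so that
the zoomed unit cylinder `x₀ + λ 𝒞 ⊆ B_{2λ}(x₀) ⊆ B_{ρ₀}(x₀)` sees only the local hypothesis.
[cite: SereginSverak2009, §4 (the rescaling before (p3), arXiv p. 11)] -/
theorem boundedNearTop_axis_of_localLogModulus
    (hloc : ∀ (v : ℝ → (EuclideanSpace ℝ (Fin 3)) → (EuclideanSpace ℝ (Fin 3))) (q : ℝ → (EuclideanSpace ℝ (Fin 3)) → ℝ),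
      IsSuitableWeakSolutionOn (SereginSverak2009.parCylOpens 0 1) 1 0 v q →
      (∃ C : ℝ≥0, ∀ᵐ t ∂(volume.restrict (Ioo (-1 : ℝ) 0)),
          ∫⁻ x in SereginSverak2009.spaceCyl 0 1, ‖v t x‖ₑ ^ 2 ≤ C) →
      (∃ G : ℝ → (EuclideanSpace ℝ (Fin 3)) → (EuclideanSpace ℝ (Fin 3)) →L[ℝ] (EuclideanSpace ℝ (Fin 3)),
          HasWeakSpatialGradientOn (SereginSverak2009.parCylOpens 0 1) v G ∧
          ∫⁻ z in SereginSverak2009.parCyl 0 1, ENNReal.ofReal (frobeniusNormSq (G z.1 z.2)) < ∞) →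
      (∫⁻ z in SereginSverak2009.parCyl 0 1, ‖q z.1 z.2‖ₑ ^ (3 / 2 : ℝ) < ∞) →
      (∀ t ∈ Ioo (-1 : ℝ) 0, IsAxisymmetric (v t)) →
      (∀ t ∈ Ioo (-1 : ℝ) 0, IsAxisymmetricScalar (q t)) →
      (∃ C₁ : ℝ, ∀ t ∈ Ioo (-1 : ℝ) 0, ∀ x ∈ SereginSverak2009.spaceCyl 0 1, 0 < cylRadius x →
          |swirl (v t) x| ≤ C₁ / Real.log (Real.exp 1 / cylRadius x) ^ 3) →
      SereginSverak2009.IsRegularAtOrigin v)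
    {ν : ℝ} (hν : 0 < ν) {T : ℝ} (hT : 0 < T) {u : ℝ → (EuclideanSpace ℝ (Fin 3)) → (EuclideanSpace ℝ (Fin 3))} {p : ℝ → (EuclideanSpace ℝ (Fin 3)) → ℝ}
    (hsm : ContDiffOn ℝ (⊤ : ℕ∞) (uncurry u) (Ioo 0 T ×ˢ univ))
    (hax : ∀ t ∈ Ioo 0 T, IsAxisymmetric (u t))
    (hpax : ∀ t ∈ Ioo 0 T, IsAxisymmetricScalar (p t))
    (hsw : IsSuitableWeakSolutionOn (slab (EuclideanSpace ℝ (Fin 3)) (Ioo 0 T) isOpen_Ioo) ν 0 u p)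
    (hcls : ∀ t₁ ∈ Ioo 0 T, ∀ ρ : ℝ, 0 < ρ →
      (∃ C : ℝ≥0, ∀ t ∈ Ioo t₁ T, ∫⁻ x in ball (0 : (EuclideanSpace ℝ (Fin 3))) ρ, ‖u t x‖ₑ ^ 2 ≤ C) ∧
      (∫⁻ z in Ioo t₁ T ×ˢ ball (0 : (EuclideanSpace ℝ (Fin 3))) ρ,
          ENNReal.ofReal (frobeniusNormSq (fderiv ℝ (u z.1) z.2)) < ∞) ∧
      (∫⁻ z in Ioo t₁ T ×ˢ ball (0 : (EuclideanSpace ℝ (Fin 3))) ρ, ‖p z.1 z.2‖ₑ ^ (3 / 2 : ℝ) < ∞))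
    {x₀ : (EuclideanSpace ℝ (Fin 3))} (hx₀ : cylRadius x₀ = 0)
    (hmod : ∃ t₀ ∈ Ioo 0 T, ∃ C δ₀ ρ₀ : ℝ, 0 < δ₀ ∧ δ₀ < 1 ∧ 0 < ρ₀ ∧
      ∀ t ∈ Ico t₀ T, ∀ x ∈ ball x₀ ρ₀, cylRadius x ≤ δ₀ →
        |swirl (u t) x| ≤ C / |Real.log (cylRadius x)| ^ 3) :
    IsBoundedNearTop u T x₀ := by
  -- adapted from Theorems/AxisymmetricExtremalityAxisymmetricKatoGlobalStubAxisBoundedOfLocalEnergyOrigin.lean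
  -- (`stub_axisBounded_of_localEnergy_origin`), with the zoom scale shrunk below `ρ₀ / 2`
  -- the axis point is `b e₃`
  obtain ⟨b, rfl⟩ : ∃ b : ℝ, x₀ = b • eZ := ⟨x₀ 2, eq_smul_eZ_of_cylRadius_eq_zero hx₀⟩
  -- the modulus and the scale
  obtain ⟨t₀, ht₀, C, δ₀, ρ₀, hδ₀, hδ₁, hρ₀, hΓ⟩ := hmod
  obtain ⟨l, hl, hlmin, hle, hlT⟩ := exists_scale hν ht₀.2 (lt_min hδ₀ (half_pos hρ₀))
  have hlδ : l ≤ δ₀ := hlmin.trans (min_le_left _ _)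
  have hlρ₀ : 2 * l ≤ ρ₀ := by linarith [hlmin.trans (min_le_right _ _)]
  set α : ℝ := l / ν with hαdef
  set β : ℝ := l ^ 2 / ν with hβdef
  have hα : 0 < α := by positivity
  have hβ : 0 < β := by positivity
  have hβeq : β = α * l := by rw [hβdef, hαdef]; field_simp
  have hβt₀ : t₀ < T - β := by rw [hβdef]; linarith
  -- the rescaled pair
  set v : ℝ → (EuclideanSpace ℝ (Fin 3)) → (EuclideanSpace ℝ (Fin 3)) := α • stPull β l T (b • eZ) u with hv
  set q : ℝ → (EuclideanSpace ℝ (Fin 3)) → ℝ := α ^ 2 • stPull β l T (b • eZ) p with hq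
  have hvs : ∀ s, v s = fun y => α • u (T + β * s) (b • eZ + l • y) := fun s => by
    funext y; rfl
  -- the rescaled times lie in `(T - β, T) ⊆ (t₀, T) ⊆ (0, T)`
  have htime : ∀ s ∈ Ioo (-1 : ℝ) 0, T + β * s ∈ Ioo t₀ T := fun s hs =>
    ⟨by nlinarith [hs.1], by nlinarith [hs.2]⟩
  have htime0 : ∀ s ∈ Ioo (-1 : ℝ) 0, T + β * s ∈ Ioo 0 T := fun s hs =>
    ⟨ht₀.1.trans (htime s hs).1, (htime s hs).2⟩
  -- (0) the unit cylinder is mapped into the strip, and into the box `(T - β, T) × B(x₀, 2λ)`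
  have hparsub := parCyl_zero_one_subset_preimage_stAffine hβ hl T (b • eZ)
  have hdom : SereginSverak2009.parCylOpens 0 1 ≤
      stPreimage β l T (b • eZ) (slab (EuclideanSpace ℝ (Fin 3)) (Ioo 0 T) isOpen_Ioo) := fun z hz => by
    have h := (mem_prod.1 (hparsub hz)).1
    rw [mem_stPreimage, mem_slab]
    exact ⟨by linarith [h.1, ht₀.1], h.2⟩
  -- the physical box lies in `(t₀, T) × B(0, ρ)`, where the classes are hypothesised
  set ρ : ℝ := ‖(b • eZ : (EuclideanSpace ℝ (Fin 3)))‖ + 2 * l with hρ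
  have hρpos : 0 < ρ := by positivity
  have hballρ : ball (b • eZ : (EuclideanSpace ℝ (Fin 3))) (2 * l) ⊆ ball 0 ρ := by
    intro x hx
    rw [mem_ball, dist_eq_norm] at hx
    rw [mem_ball, dist_zero_right, hρ]
    linarith [norm_le_norm_add_norm_sub' x (b • eZ : (EuclideanSpace ℝ (Fin 3)))]
  have hPBsub : Ioo (T - β) T ×ˢ ball (b • eZ : (EuclideanSpace ℝ (Fin 3))) (2 * l) ⊆ Ioo t₀ T ×ˢ ball 0 ρ :=
    prod_mono (Ioo_subset_Ioo_left hβt₀.le) hballρ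
  obtain ⟨⟨CA, hCA⟩, hgradfin, hpresfin⟩ := hcls t₀ ht₀ ρ hρpos
  -- (1) the rescaled pair is a suitable weak solution of the unit-viscosity system on `Q(0, 1)`
  have hsuitv : IsSuitableWeakSolutionOn (SereginSverak2009.parCylOpens 0 1) 1 0 v q := by
    have h0 := hsw.stRescale hα hl hβeq T (b • eZ)
    have hvisc : α * ν / l = 1 := by
      rw [hαdef, div_mul_cancel₀ l hν.ne', div_self hl.ne']
    have hforce : ((α ^ 2 * l) • stPull β l T (b • eZ) (0 : ℝ → (EuclideanSpace ℝ (Fin 3)) → (EuclideanSpace ℝ (Fin 3)))) = 0 := by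
      funext s y; simp [stPull]
    rw [hvisc, hforce] at h0
    exact h0.of_le hdom
  -- (2) `v ∈ L_{2,∞}(Q)`
  have hA : ∃ C : ℝ≥0, ∀ᵐ s ∂(volume.restrict (Ioo (-1 : ℝ) 0)),
      ∫⁻ y in SereginSverak2009.spaceCyl 0 1, ‖v s y‖ₑ ^ 2 ≤ C := by
    have hphys : ∀ᵐ t ∂(volume.restrict (Ioo (T + β * (-1)) (T + β * 0))),
        ∫⁻ x in ball (b • eZ : (EuclideanSpace ℝ (Fin 3))) (2 * l), ‖u t x‖ₑ ^ 2 ≤ (CA : ℝ≥0∞) := by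
      refine (ae_restrict_mem measurableSet_Ioo).mono fun t ht => ?_
      exact (lintegral_mono_set hballρ).trans (hCA t ⟨by linarith [ht.1], by linarith [ht.2]⟩)
    have h2 := ae_sliced_setLIntegral_ball_stRescale hβ hl T (b • eZ) (b • eZ) (2 * l) (-1) 0
      (fun t x => ‖u t x‖ₑ ^ 2) hphys
    have h2l : 2 * l / l = 2 := by rw [mul_div_assoc, div_self hl.ne', mul_one]
    rw [finrank_euclideanSpace_fin, sub_self, smul_zero, h2l] at h2
    set C₁ : ℝ≥0∞ := ‖α‖ₑ ^ 2 * (ENNReal.ofReal (l ^ 3)⁻¹ * CA) with hC₁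
    have hC₁top : C₁ ≠ ∞ :=
      ENNReal.mul_ne_top (by simp) (ENNReal.mul_ne_top ENNReal.ofReal_ne_top ENNReal.coe_ne_top)
    refine ⟨C₁.toNNReal, ?_⟩
    rw [ENNReal.coe_toNNReal hC₁top]
    filter_upwards [h2] with s hs
    have e : ∀ y : (EuclideanSpace ℝ (Fin 3)), ‖v s y‖ₑ ^ 2 = ‖α‖ₑ ^ 2 * ‖u (T + β * s) (b • eZ + l • y)‖ₑ ^ 2 := by
      intro y
      rw [hvs s]
      simp only [enorm_smul, mul_pow]
    simp only [e]
    rw [lintegral_const_mul' _ _ (by simp)]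
    exact mul_le_mul' le_rfl ((lintegral_mono_set spaceCyl_zero_one_subset_ball).trans hs)
  -- (3) `∇v = (α λ) ∇u ∘ Φ ∈ L₂(Q)`
  set G : ℝ → (EuclideanSpace ℝ (Fin 3)) → (EuclideanSpace ℝ (Fin 3)) →L[ℝ] (EuclideanSpace ℝ (Fin 3)) :=
    (α * l) • stPull β l T (b • eZ) (fun t x => fderiv ℝ (u t) x) with hG
  have hGu : HasWeakSpatialGradientOn (slab (EuclideanSpace ℝ (Fin 3)) (Ioo 0 T) isOpen_Ioo) u
      fun t x => fderiv ℝ (u t) x :=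
    hasWeakSpatialGradientOn_of_contDiffOn isOpen_Ioo (by rw [coe_slab]) (hsm.of_le (by norm_cast))
  have hGv : HasWeakSpatialGradientOn (SereginSverak2009.parCylOpens 0 1) v G :=
    (hGu.stRescale α hβ hl T (b • eZ)).mono hdom
  have hGfin : ∫⁻ z in SereginSverak2009.parCyl 0 1, ENNReal.ofReal (frobeniusNormSq (G z.1 z.2)) < ∞ := by
    refine lt_of_le_of_lt (lintegral_mono_set hparsub) ?_
    rw [hG, setLIntegral_frobeniusNormSq_stRescale hβ hl T (b • eZ) (α * l), finrank_euclideanSpace_fin]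
    refine ENNReal.mul_lt_top (ENNReal.mul_lt_top ENNReal.ofReal_lt_top ENNReal.ofReal_lt_top) ?_
    exact lt_of_le_of_lt (lintegral_mono_set hPBsub) hgradfin
  -- (4) `q ∈ L_{3/2}(Q)`
  have hqfin : ∫⁻ z in SereginSverak2009.parCyl 0 1, ‖q z.1 z.2‖ₑ ^ (3 / 2 : ℝ) < ∞ := by
    refine lt_of_le_of_lt (lintegral_mono_set hparsub) ?_
    rw [hq, setLIntegral_enorm_rpow_stRescale hβ hl T (b • eZ) (α ^ 2) p _ (by norm_num),
      finrank_euclideanSpace_fin]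
    refine ENNReal.mul_lt_top (ENNReal.mul_lt_top
      (ENNReal.rpow_lt_top_of_nonneg (by norm_num) enorm_ne_top) ENNReal.ofReal_lt_top) ?_
    exact lt_of_le_of_lt (lintegral_mono_set hPBsub) hpresfin
  -- (5) axisymmetry of the rescaled slices (`b e₃` is fixed by the rotations, which are linear)
  have hvax : ∀ s ∈ Ioo (-1 : ℝ) 0, IsAxisymmetric (v s) := fun s hs => by
    rw [hvs s]; exact SereginSverak2009.isAxisymmetric_rescale (hax _ (htime0 s hs)) α b l
  have hqax : ∀ s ∈ Ioo (-1 : ℝ) 0, IsAxisymmetricScalar (q s) := by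
    intro s hs θ y
    show α ^ 2 • p (T + β * s) (b • eZ + l • rotZ θ y) = α ^ 2 • p (T + β * s) (b • eZ + l • y)
    rw [← SereginSverak2009.rotZ_smul_eZ_add_smul, hpax _ (htime0 s hs) θ]
  -- (6) the swirl bound: `Γ_v(s, y) = ν⁻¹ Γ_u(Φ(s, y))` and `|log (λ r)| ≥ log (e/r)`; the zoomed unit
  -- cylinder lies in the ball `B_{ρ₀}(x₀)` of the LOCAL hypothesis (`‖λ y‖ < 2λ ≤ ρ₀`)
  have hswirl : ∃ C₁ : ℝ, ∀ s ∈ Ioo (-1 : ℝ) 0, ∀ y ∈ SereginSverak2009.spaceCyl 0 1,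
      0 < cylRadius y → |swirl (v s) y| ≤ C₁ / Real.log (Real.exp 1 / cylRadius y) ^ 3 := by
    refine ⟨max C 0 / ν, fun s hs y hy hry => ?_⟩
    have hyball : b • eZ + l • y ∈ ball (b • eZ : (EuclideanSpace ℝ (Fin 3))) ρ₀ := by
      have hy2 : ‖y‖ < 2 := by
        have h := spaceCyl_zero_one_subset_ball hy
        rwa [mem_ball, dist_zero_right] at h
      rw [mem_ball, dist_eq_norm, add_sub_cancel_left, norm_smul, Real.norm_of_nonneg hl.le]
      nlinarith
    rw [hvs s, swirl_smul_comp_eZ_smul (u (T + β * s)) α b hl.ne' y]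
    have hαl : α / l = ν⁻¹ := by
      rw [hαdef, div_div, mul_comm ν l, ← div_div, div_self hl.ne', one_div]
    rw [hαl, abs_mul, abs_of_pos (inv_pos.2 hν)]
    rw [SereginSverak2009.mem_spaceCyl] at hy
    have hr1 : cylRadius y < 1 := by simpa using hy.1
    have hcx : cylRadius (b • eZ + l • y) = l * cylRadius y := by
      rw [SereginSverak2009.cylRadius_smul_eZ_add, cylRadius_smul, abs_of_pos hl]
    have hlr : l * cylRadius y ≤ δ₀ := by nlinarith
    have ht : T + β * s ∈ Ico t₀ T := ⟨(htime s hs).1.le, (htime s hs).2⟩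
    have hbound := hΓ _ ht (b • eZ + l • y) hyball (by rw [hcx]; exact hlr)
    rw [hcx] at hbound
    obtain ⟨hLpos, hLle⟩ := log_exp_one_div_le_abs_log_mul hl hle hry hr1
    have hL3 : Real.log (Real.exp 1 / cylRadius y) ^ 3 ≤ |Real.log (l * cylRadius y)| ^ 3 :=
      pow_le_pow_left₀ hLpos.le hLle 3
    have h1 : |swirl (u (T + β * s)) (b • eZ + l • y)| ≤
        max C 0 / Real.log (Real.exp 1 / cylRadius y) ^ 3 :=
      calc |swirl (u (T + β * s)) (b • eZ + l • y)| ≤ C / |Real.log (l * cylRadius y)| ^ 3 := hbound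
        _ ≤ max C 0 / |Real.log (l * cylRadius y)| ^ 3 :=
          div_le_div_of_nonneg_right (le_max_left _ _) (by positivity)
        _ ≤ max C 0 / Real.log (Real.exp 1 / cylRadius y) ^ 3 :=
          div_le_div_of_nonneg_left (le_max_right _ _) (pow_pos hLpos 3) hL3
    calc ν⁻¹ * |swirl (u (T + β * s)) (b • eZ + l • y)|
        ≤ ν⁻¹ * (max C 0 / Real.log (Real.exp 1 / cylRadius y) ^ 3) :=
          mul_le_mul_of_nonneg_left h1 (inv_nonneg.2 hν.le)
      _ = max C 0 / ν / Real.log (Real.exp 1 / cylRadius y) ^ 3 := by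
          rw [div_div, mul_comm ν, ← div_div, div_eq_inv_mul _ ν]
  -- (7) the criterion: `v` is essentially bounded near the vertex; transport back to `u`
  obtain ⟨r, hr, hbd⟩ := hloc v q hsuitv hA ⟨G, hGv, hGfin⟩ hqfin hvax hqax hswirl
  have hbd' : eLpNorm (uncurry v) ∞ (volume.restrict (parabolicCylinder r 0)) < ∞ :=
    lt_of_le_of_lt (eLpNorm_mono_measure _
      (Measure.restrict_mono_set _ (parabolicCylinder_subset_parCyl 0 r))) hbd
  exact isBoundedNearTop_of_eLpNorm_rescaled_lt_top hT hsm.continuousOn (b • eZ) hα hβ hl hr hbd'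

/-- **The shadow of the crux at an AXIS point, from Seregin's 2022 local criterion and a LOCAL log³ modulus
of the swirl.** Assume the named fact `seregin2022_logSwirl_regularAtOrigin` (G. Seregin, J. Math. Fluid
Mech. 24 (2022), §2 — published, undischarged in the tree). For `ν > 0`, `T > 0`, a classical solution
`(u, p)` on `ℝ³ × [0, T)`, Leray–Hopf from its rapidly decaying datum, with axisymmetric velocity slices on
`(0, T)`, an axis point `x₀` (`cylRadius x₀ = 0`), and the local modulus `|Γ(t, x)| ≤ C / |log (cylRadius x)|³`
for `t₀ ≤ t < T`, `x ∈ B_{ρ₀}(x₀)`, `cylRadius x ≤ δ₀ < 1`: `u` is bounded on some `(T − r², T) × B_r(x₀)` (the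
conclusion of the crux verbatim). Proof: `exists_axisymmetric_suitable_pressure` +
`boundedNearTop_axis_of_localLogModulus`. [cite: Seregin2022LocalAxisym, §2 Thm. 1.2 (engine (2.2))] -/
theorem csrShadow_axis_of_seregin2022 (h2a : seregin2022_logSwirl_regularAtOrigin)
    {ν T : ℝ} (hν : 0 < ν) (hT : 0 < T) {u : ℝ → (EuclideanSpace ℝ (Fin 3)) → (EuclideanSpace ℝ (Fin 3))} {p : ℝ → (EuclideanSpace ℝ (Fin 3)) → ℝ}
    (hcl : IsClassicalNSSolutionOn (Ico 0 T) ν 0 u p) (hLH : IsLerayHopfOn T ν 0 (u 0) u)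
    (hdec : HasRapidSpatialDecay (u 0)) (hax : ∀ t ∈ Ioo 0 T, IsAxisymmetric (u t))
    {x₀ : (EuclideanSpace ℝ (Fin 3))} (hx₀ : cylRadius x₀ = 0)
    (hmod : ∃ t₀ ∈ Ioo 0 T, ∃ C δ₀ ρ₀ : ℝ, 0 < δ₀ ∧ δ₀ < 1 ∧ 0 < ρ₀ ∧
      ∀ t ∈ Ico t₀ T, ∀ x ∈ ball x₀ ρ₀, cylRadius x ≤ δ₀ →
        |swirl (u t) x| ≤ C / |Real.log (cylRadius x)| ^ 3) :
    ∃ r : ℝ, 0 < r ∧ ∃ K : ℝ, ∀ t ∈ Ioo (T - r ^ 2) T, 0 ≤ t → ∀ x ∈ ball x₀ r, ‖u t x‖ ≤ K := by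
  obtain ⟨q, hqax, hsw, hcls⟩ := exists_axisymmetric_suitable_pressure hν hT hcl hLH hdec hax
  obtain ⟨r, hr, K, hK⟩ := boundedNearTop_axis_of_localLogModulus h2a hν hT
    (contDiffOn_Ioo_of_classical hcl) hax hqax hsw hcls hx₀ hmod
  exact ⟨r, hr, K, fun t ht _ x hx => hK t ht x hx⟩

/-- **The shadow of the crux at EVERY point, from Seregin 2022, under a local log³ modulus of the swirl at
the axis** (the two previous statements combined: off the axis nothing is needed, on the axis the local
modulus). This is the exactly-flat instance (`α = Γ`, `d = r`) of the D4 restatement of the crux — the v0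
gauge block plus a scale-invariant log-Dirichlet clause `|α| ≤ C₁ ν / log³(e ρ / d)` on the momentum at the
degeneracy set — whose shadow is therefore a printed theorem (Seregin 2022), not an open problem.
[cite: Seregin2022LocalAxisym, §2 Thm. 1.2 (engine (2.2))] -/
theorem csrShadow_of_seregin2022 (h2a : seregin2022_logSwirl_regularAtOrigin)
    {ν T : ℝ} (hν : 0 < ν) (hT : 0 < T) {u : ℝ → (EuclideanSpace ℝ (Fin 3)) → (EuclideanSpace ℝ (Fin 3))} {p : ℝ → (EuclideanSpace ℝ (Fin 3)) → ℝ}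
    (hcl : IsClassicalNSSolutionOn (Ico 0 T) ν 0 u p) (hLH : IsLerayHopfOn T ν 0 (u 0) u)
    (hdec : HasRapidSpatialDecay (u 0)) (hax : ∀ t ∈ Ioo 0 T, IsAxisymmetric (u t)) (x₀ : (EuclideanSpace ℝ (Fin 3)))
    (hmod : cylRadius x₀ = 0 → ∃ t₀ ∈ Ioo 0 T, ∃ C δ₀ ρ₀ : ℝ, 0 < δ₀ ∧ δ₀ < 1 ∧ 0 < ρ₀ ∧
      ∀ t ∈ Ico t₀ T, ∀ x ∈ ball x₀ ρ₀, cylRadius x ≤ δ₀ →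
        |swirl (u t) x| ≤ C / |Real.log (cylRadius x)| ^ 3) :
    ∃ r : ℝ, 0 < r ∧ ∃ K : ℝ, ∀ t ∈ Ioo (T - r ^ 2) T, 0 ≤ t → ∀ x ∈ ball x₀ r, ‖u t x‖ ≤ K := by
  by_cases hx₀ : cylRadius x₀ = 0
  · exact csrShadow_axis_of_seregin2022 h2a hν hT hcl hLH hdec hax hx₀ (hmod hx₀)
  · exact csrShadow_offAxis hν hT hcl hLH hdec hax hx₀

/-- **`CriticalSwirlRegularity` restricted to axisymmetric velocities holds OFF the axis — the lower bound of
the hardness sandwich with its crux hypothesis REMOVED at off-axis points.** Same binders as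
`bounded_of_criticalSwirlRegularity_of_axisymmetric` (`HardnessSandwich.lean`) except that neither the crux,
nor the axisymmetry of the pressure, nor the gauge bounds `|Γ| ≤ M`, `‖ω‖ r ≤ C ‖∇Γ‖` are assumed: for
`cylRadius x₀ ≠ 0` the conclusion is unconditional (`csrShadow_offAxis`). [cite: CKN1982, Thm. B] -/
theorem bounded_of_axisymmetric_offAxis
    {ν T : ℝ} (hν : 0 < ν) (hT : 0 < T)
    {u : ℝ → (EuclideanSpace ℝ (Fin 3)) → (EuclideanSpace ℝ (Fin 3))} {p : ℝ → (EuclideanSpace ℝ (Fin 3)) → ℝ}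
    (h : IsClassicalNSSolutionOn (Ico 0 T) ν 0 u p) (hLH : IsLerayHopfOn T ν 0 (u 0) u)
    (hdec : HasRapidSpatialDecay (u 0)) (hu : ∀ t ∈ Ico 0 T, IsAxisymmetric (u t))
    {x₀ : (EuclideanSpace ℝ (Fin 3))} (hx₀ : cylRadius x₀ ≠ 0) :
    ∃ r : ℝ, 0 < r ∧ ∃ K : ℝ, ∀ t ∈ Ioo (T - r ^ 2) T, 0 ≤ t → ∀ x ∈ ball x₀ r, ‖u t x‖ ≤ K :=
  csrShadow_offAxis hν hT h hLH hdec (fun t ht => hu t (Ioo_subset_Ico_self ht)) hx₀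

end Summit.NavierStokesRegularity.NavierStokesRegularity.Theorems.CriticalSwirlRegularity.Negative

end
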